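import Summits.CriticalPhenomena.Ising3DConformalLimit.Theorems.HarmonicMomentsIsotropyHarmonicDilutionGaussianRungFiltration
import HarnessLib

/-!
# Route HarmonicMomentsIsotropy — the Gaussian rung of `HarmonicDilution`, Ib: the symbol of `N`

Support file for item `stmt-CriticalPhenomena-6034` (`HarmonicDilution`), continuing
`…GaussianRungFiltration`.  The discrete Laplacian `N = ∑ᵢ (τᵢ + τᵢ⁻¹ - 2)` of `ℤ³` acting on
`ℝ[X₀,X₁,X₂]` agrees with the Laplacian `Δ` to top order — the mechanism "harmonic polynomials
see through (cubic-symmetric) convolutions" of the route's idea card in its exact algebraic form: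

* `dlap_sub_lap_mem` — **symbol computation**: `N P - Δ P` lies four degree-filtration steps below
  `P` (on monomials: `(X+1)^a + (X-1)^a - 2X^a - a(a-1)X^{a-2}` has degree `≤ a - 4`,
  `bracket_mem_degFilt`, whose numerical content is `bracket_coeff_eq_zero`);
* `dlap_iterate_sub_mem`, `dlap_iterate_eq_lap_iterate`, `dlap_iterate_eq_zero` — hence
  `N^k P = Δ^k P` once `deg P < 2k + 2` and `N^k P = 0` once `deg P < 2k`;
* `eval_zero_dlap_iterate_rsq_pow_mul_eq_zero` — for `Y` HARMONIC homogeneous of degree `n ≥ 1`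
  the constants `(N^k(|x|^{2m}Y))(0)` vanish for `n + 2m < 2k + 2` ("harmonic moments are
  unsourced at top order"), while `dlap_iterate_rsq_pow_self` — `N^p |x|^{2p} = γ_p · 1`, `γ_p > 0`
  ("isotropic moments are sourced").

With `E[W(Sₙ)] = ((1 + N/6)ⁿ W)(0)` for the simple random walk `Sₙ` (file `…GaussianRungMoments`)
these are exactly the statements that the harmonic moments of `D^{⋆n}` are polynomials in `n` of
degree `< (n+2m)/2` while `E|Sₙ|^{2p}` has degree `p` — CampostriniEtAl1998 §4.2 (`ρ = 2`).
-/

noncomputable section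

open MvPolynomial Finset

namespace Summit.CriticalPhenomena.Ising3DConformalLimit.Theorems.HarmonicMomentsIsotropy.GaussianRung

open Summit.CriticalPhenomena.Ising3DConformalLimit.Theorems.HarmonicMomentsIsotropy.Fischer
  (Poly rsq lap lap_apply rsq_isHomogeneous lap_one aCoef aCoef_pos
    lap_iterate_rsq_pow_mul_harmonic lap_iterate_rsq_pow_mul_harmonic_eq_zero)

/-! ## The symbol computation: `N - Δ` lowers the degree by four -/

/-- The numerical heart: for `k ≤ a < k + 4` the coefficient of `X^k` in
`(X+1)^a + (X-1)^a - 2X^a - a(a-1)X^{a-2}` vanishes. -/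
theorem bracket_coeff_eq_zero (a k : ℕ) (hk : k ≤ a) (h : a < k + 4) :
    (1 + (-1 : ℝ) ^ (a - k)) * (a.choose k : ℝ) - (if k = a then 2 else 0) -
      (if k = a - 2 then (a : ℝ) * ((a - 1 : ℕ) : ℝ) else 0) = 0 := by
  obtain ⟨j, rfl⟩ : ∃ j, a = k + j := ⟨a - k, by omega⟩
  have hj : j < 4 := by omega
  interval_cases j
  · simp only [add_zero, Nat.sub_self, pow_zero, Nat.choose_self, Nat.cast_one, if_true]
    split_ifs with h'
    · have hk' : k = 0 ∨ k = 1 := by omega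
      rcases hk' with rfl | rfl <;> norm_num
    · norm_num
  · have e1 : k + 1 - k = 1 := by omega
    rw [e1, if_neg (by omega)]
    split_ifs with h'
    · have hk0 : k = 0 := by omega
      subst hk0; norm_num
    · norm_num
  · have e1 : k + 2 - k = 2 := by omega
    have e2 : k + 2 - 2 = k := by omega
    rw [e1, if_neg (by omega), e2, if_pos rfl]
    have h1 : (k + 2).choose k = (k + 2).choose 2 := by
      rw [show k + 2 = 2 + k by ring, Nat.choose_symm_add]
    have h2 : (k + 2).choose 2 * 2 = (k + 2) * (k + 2 - 1) := by
      rw [Nat.choose_two_right, Nat.div_mul_cancel]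
      exact (Nat.even_mul_pred_self (k + 2)).two_dvd
    have e3 : (k + 2 - 1 : ℕ) = k + 1 := by omega
    rw [e3] at h2 ⊢
    have hc : ((k + 2).choose k : ℝ) * 2 = ((k + 2 : ℕ) : ℝ) * ((k + 1 : ℕ) : ℝ) := by
      rw [h1]; exact_mod_cast h2
    push_cast at hc ⊢
    linarith
  · have e1 : k + 3 - k = 3 := by omega
    rw [e1, if_neg (by omega), if_neg (by omega)]
    norm_num

/-- The univariate bracket `(Xᵢ+1)^a + (Xᵢ-1)^a - 2Xᵢ^a - a(a-1)Xᵢ^{a-2}` has degree `≤ a - 4`. -/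
theorem bracket_mem_degFilt (i : Fin 3) (a : ℕ) :
    ((X i + C 1) ^ a + (X i + C (-1)) ^ a - (2 : ℝ) • X i ^ a -
      ((a : ℝ) * ((a - 1 : ℕ) : ℝ)) • X i ^ (a - 2) : Poly) ∈ degFilt ((a : ℤ) - 4) := by
  -- binomial expansions as `ℝ`-linear combinations of powers of `Xᵢ`
  have hexp : ∀ c : ℝ, (X i + C c : Poly) ^ a =
      ∑ k ∈ range (a + 1), (c ^ (a - k) * (a.choose k : ℝ)) • (X i : Poly) ^ k := by
    intro c
    rw [add_pow]
    refine Finset.sum_congr rfl fun k _ => ?_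
    rw [← map_pow, ← map_natCast C, mul_assoc, ← map_mul, mul_comm, ← smul_eq_C_mul]
  have h2 : (2 : ℝ) • (X i : Poly) ^ a =
      ∑ k ∈ range (a + 1), (if k = a then (2 : ℝ) else 0) • (X i : Poly) ^ k := by
    rw [Finset.sum_eq_single a (fun k _ hk => by rw [if_neg hk, zero_smul])
      (fun h => absurd (mem_range.mpr (Nat.lt_succ_self a)) h), if_pos rfl]
  have h3 : ((a : ℝ) * ((a - 1 : ℕ) : ℝ)) • (X i : Poly) ^ (a - 2) =
      ∑ k ∈ range (a + 1), (if k = a - 2 then (a : ℝ) * ((a - 1 : ℕ) : ℝ) else 0) •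
        (X i : Poly) ^ k := by
    rw [Finset.sum_eq_single (a - 2) (fun k _ hk => by rw [if_neg hk, zero_smul])
      (fun h => absurd (mem_range.mpr (by omega)) h), if_pos rfl]
  rw [hexp 1, hexp (-1), h2, h3, ← Finset.sum_add_distrib, ← Finset.sum_sub_distrib,
    ← Finset.sum_sub_distrib]
  refine sum_mem_degFilt _ fun k hk => ?_
  rw [← add_smul, ← sub_smul, ← sub_smul]
  have hk' : k ≤ a := Nat.lt_succ_iff.mp (mem_range.mp hk)
  by_cases hdeg : a < k + 4
  · have hz := bracket_coeff_eq_zero a k hk' hdeg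
    have e : (1 : ℝ) ^ (a - k) * (a.choose k : ℝ) + (-1 : ℝ) ^ (a - k) * (a.choose k : ℝ) =
        (1 + (-1 : ℝ) ^ (a - k)) * (a.choose k : ℝ) := by ring
    rw [e, hz, zero_smul]
    exact Submodule.zero_mem _
  · refine Submodule.smul_mem _ _ (degFilt_mono ?_ (pow_mem_degFilt (X_mem_degFilt i) k))
    rw [mul_one]
    omega

/-- The exponent-`s` monomial splits off its `i`-th variable. -/
theorem monomial_eq_X_pow_mul (i : Fin 3) (s : Fin 3 →₀ ℕ) :
    (monomial s (1 : ℝ) : Poly) = X i ^ (s i) * monomial (Finsupp.erase i s) 1 := by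
  conv_lhs => rw [← Finsupp.single_add_erase i s]
  rw [X_pow_eq_monomial, monomial_mul, one_mul]

/-- Translating in direction `i` fixes a monomial without `Xᵢ`. -/
theorem shiftAlg_monomial_erase (i : Fin 3) (c : ℝ) (s : Fin 3 →₀ ℕ) :
    shiftAlg i c (monomial (Finsupp.erase i s) 1) = monomial (Finsupp.erase i s) 1 := by
  unfold shiftAlg
  rw [bind₁_monomial, monomial_eq, C_1, Finsupp.prod]
  congr 1
  refine Finset.prod_congr rfl fun j hj => ?_
  have hji : j ≠ i := by
    rw [Finsupp.support_erase] at hj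
    exact Finset.ne_of_mem_erase hj
  rw [if_neg hji, C_0, add_zero]

/-- `∂ᵢ` kills a monomial without `Xᵢ`. -/
theorem pderiv_monomial_erase (i : Fin 3) (s : Fin 3 →₀ ℕ) :
    pderiv i (monomial (Finsupp.erase i s) (1 : ℝ) : Poly) = 0 := by
  rw [pderiv_monomial, Finsupp.erase_same, Nat.cast_zero, mul_zero, monomial_zero]

/-- `∂ᵢ² Xᵢ^a = a(a-1) Xᵢ^{a-2}`. -/
theorem pderiv_pderiv_X_pow (i : Fin 3) (a : ℕ) :
    pderiv i (pderiv i ((X i : Poly) ^ a)) = ((a : ℝ) * ((a - 1 : ℕ) : ℝ)) • X i ^ (a - 2) := by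
  rw [X_pow_eq_monomial, pderiv_monomial, Finsupp.single_eq_same, ← Finsupp.single_tsub,
    pderiv_monomial, Finsupp.single_eq_same, ← Finsupp.single_tsub, X_pow_eq_monomial,
    smul_monomial, smul_eq_mul, mul_one, one_mul, tsub_tsub]

/-- On a monomial, `(τᵢ + τᵢ⁻¹ - 2) - ∂ᵢ²` lowers the degree by four. -/
theorem sdiff_sub_monomial_mem (i : Fin 3) (s : Fin 3 →₀ ℕ) :
    sdiff i (monomial s 1) - pderiv i (pderiv i (monomial s 1)) ∈ degFilt (ideg s - 4) := by
  set a := s i with ha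
  set R : Poly := monomial (Finsupp.erase i s) 1 with hR
  have hmono := monomial_eq_X_pow_mul i s
  have hshift : ∀ c : ℝ, shiftAlg i c (monomial s 1) = (X i + C c) ^ a * R := by
    intro c
    rw [hmono, map_mul, map_pow, shiftAlg_X, if_pos rfl, shiftAlg_monomial_erase]
  have hpd : pderiv i (pderiv i (monomial s (1 : ℝ) : Poly)) =
      (((a : ℝ) * ((a - 1 : ℕ) : ℝ)) • X i ^ (a - 2)) * R := by
    rw [hmono, pderiv_mul, pderiv_monomial_erase, mul_zero, add_zero, pderiv_mul,
      pderiv_monomial_erase, mul_zero, add_zero, pderiv_pderiv_X_pow]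
  have e : sdiff i (monomial s 1) - pderiv i (pderiv i (monomial s 1)) =
      ((X i + C 1) ^ a + (X i + C (-1)) ^ a - (2 : ℝ) • X i ^ a -
        ((a : ℝ) * ((a - 1 : ℕ) : ℝ)) • X i ^ (a - 2)) * R := by
    rw [sdiff_apply, hshift, hshift, hpd]
    conv_lhs => rw [hmono]
    simp only [smul_eq_C_mul]
    ring
  rw [e]
  have hdegR : R ∈ degFilt (ideg (Finsupp.erase i s)) := monomial_mem_degFilt _ _
  have hsum : ideg (Finsupp.erase i s) = ideg s - a := by
    have := congrArg ideg (Finsupp.single_add_erase i s)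
    rw [ideg_add, ideg_single] at this
    omega
  refine degFilt_mono ?_ (mul_mem_degFilt (bracket_mem_degFilt i a) hdegR)
  omega

/-- **Symbol computation**: `N P - Δ P` lies four filtration steps below `P`. -/
theorem dlap_sub_lap_mem {P : Poly} {d : ℤ} (hP : P ∈ degFilt d) :
    dlap P - lap P ∈ degFilt (d - 4) := by
  have h := linear_mem_degFilt (dlap - lap) 4 (fun s => ?_) hP
  · simpa only [LinearMap.sub_apply] using h
  · rw [LinearMap.sub_apply, dlap, LinearMap.coe_sum, Finset.sum_apply, lap_apply,
      ← Finset.sum_sub_distrib]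
    exact sum_mem_degFilt _ fun i _ => sdiff_sub_monomial_mem i s

/-- The discrete Laplacian lowers the filtration by two. -/
theorem dlap_mem_degFilt {P : Poly} {d : ℤ} (hP : P ∈ degFilt d) : dlap P ∈ degFilt (d - 2) := by
  have e : dlap P = (dlap P - lap P) + lap P := by abel
  rw [e]
  exact Submodule.add_mem _ (degFilt_mono (by omega) (dlap_sub_lap_mem hP)) (lap_mem_degFilt hP)

/-- Iterated discrete Laplacians lower the filtration by two each. -/
theorem dlap_iterate_mem_degFilt {P : Poly} {d : ℤ} (hP : P ∈ degFilt d) :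
    ∀ k : ℕ, dlap^[k] P ∈ degFilt (d - 2 * k)
  | 0 => by simpa using hP
  | k + 1 => by
    rw [Function.iterate_succ_apply']
    have h := dlap_mem_degFilt (dlap_iterate_mem_degFilt hP k)
    have e : d - 2 * (k : ℤ) - 2 = d - 2 * ((k + 1 : ℕ) : ℤ) := by push_cast; ring
    rwa [e] at h

/-- **`N^k P - Δ^k P` lies in step `deg P - 2k - 2`.** -/
theorem dlap_iterate_sub_mem {P : Poly} {d : ℤ} (hP : P ∈ degFilt d) :
    ∀ k : ℕ, dlap^[k] P - lap^[k] P ∈ degFilt (d - 2 * k - 2)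
  | 0 => by
    simp only [Function.iterate_zero, id_eq, sub_self]
    exact Submodule.zero_mem _
  | k + 1 => by
    rw [Function.iterate_succ_apply', Function.iterate_succ_apply']
    have e : dlap (dlap^[k] P) - lap (lap^[k] P) =
        dlap (dlap^[k] P - lap^[k] P) + (dlap (lap^[k] P) - lap (lap^[k] P)) := by
      rw [map_sub]; abel
    rw [e]
    refine Submodule.add_mem _ (degFilt_mono ?_ (dlap_mem_degFilt (dlap_iterate_sub_mem hP k)))
      (degFilt_mono ?_ (dlap_sub_lap_mem (lap_iterate_mem_degFilt hP k))) <;>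
      push_cast <;> omega

/-- Once `deg P < 2k + 2`, the lattice and continuum iterates agree: `N^k P = Δ^k P`. -/
theorem dlap_iterate_eq_lap_iterate {P : Poly} {d : ℤ} (hP : P ∈ degFilt d) {k : ℕ}
    (hk : d < 2 * k + 2) : dlap^[k] P = lap^[k] P :=
  sub_eq_zero.mp (eq_zero_of_mem_degFilt (dlap_iterate_sub_mem hP k) (by omega))

/-- Once `deg P < 2k`, `N^k P = 0`. -/
theorem dlap_iterate_eq_zero {P : Poly} {d : ℤ} (hP : P ∈ degFilt d) {k : ℕ} (hk : d < 2 * k) :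
    dlap^[k] P = 0 :=
  eq_zero_of_mem_degFilt (dlap_iterate_mem_degFilt hP k) (by omega)

/-! ## Harmonic weights: top-order lattice moments vanish -/

/-- A homogeneous polynomial of positive degree vanishes at the origin. -/
theorem eval_zero_of_isHomogeneous {Y : Poly} {n : ℕ} (hY : Y.IsHomogeneous n) (hn : 1 ≤ n) :
    eval (0 : Fin 3 → ℝ) Y = 0 := by
  rw [eval_zero, constantCoeff_eq]
  refine hY.coeff_eq_zero ?_
  rw [map_zero]
  omega

/-- **Harmonic moments are unsourced at top order.**  For `Y` harmonic homogeneous of degree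
`n ≥ 1` and `n + 2m < 2k + 2`, the constant `(N^k (|x|^{2m} Y))(0)` vanishes. -/
theorem eval_zero_dlap_iterate_rsq_pow_mul_eq_zero {Y : Poly} {n : ℕ} (hY : Y.IsHomogeneous n)
    (hn : 1 ≤ n) (hlap : lap Y = 0) (m : ℕ) {k : ℕ} (hk : n + 2 * m < 2 * k + 2) :
    eval 0 (dlap^[k] (rsq ^ m * Y)) = 0 := by
  have hdeg := mem_degFilt_of_isHomogeneous ((rsq_isHomogeneous.pow m).mul hY)
  rw [dlap_iterate_eq_lap_iterate hdeg (by push_cast; omega)]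
  rcases le_or_gt k m with hkm | hkm
  · rw [lap_iterate_rsq_pow_mul_harmonic hY hlap m k hkm, smul_eval, map_mul,
      eval_zero_of_isHomogeneous hY hn, mul_zero, mul_zero]
  · rw [lap_iterate_rsq_pow_mul_harmonic_eq_zero hY hlap m k hkm, map_zero]

/-- **Isotropic moments are sourced**: `N^p |x|^{2p} = γ_p` with `γ_p > 0`. -/
theorem dlap_iterate_rsq_pow_self (p : ℕ) :
    ∃ γ : ℝ, 0 < γ ∧ dlap^[p] (rsq ^ p) = γ • (1 : Poly) := by
  have hdeg := mem_degFilt_of_isHomogeneous (rsq_isHomogeneous.pow p)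
  rw [dlap_iterate_eq_lap_iterate hdeg (by push_cast; omega)]
  have h := lap_iterate_rsq_pow_mul_harmonic (isHomogeneous_one (Fin 3) ℝ) lap_one p p le_rfl
  rw [mul_one, Nat.sub_self, pow_zero, mul_one] at h
  exact ⟨_, Finset.prod_pos fun l _ => aCoef_pos _ _, h⟩

/-- Beyond the top order every lattice moment of `|x|^{2p}` vanishes: `N^k |x|^{2p} = 0`, `p < k`. -/
theorem dlap_iterate_rsq_pow_eq_zero {p k : ℕ} (h : p < k) : dlap^[k] (rsq ^ p) = 0 :=
  dlap_iterate_eq_zero (mem_degFilt_of_isHomogeneous (rsq_isHomogeneous.pow p))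
    (by push_cast; omega)

/-- Beyond half the degree every lattice moment of `|x|^{2m} Y` vanishes. -/
theorem dlap_iterate_rsq_pow_mul_eq_zero {Y : Poly} {n : ℕ} (hY : Y.IsHomogeneous n) (m : ℕ)
    {k : ℕ} (hk : n + 2 * m < 2 * k) : dlap^[k] (rsq ^ m * Y) = 0 :=
  dlap_iterate_eq_zero (mem_degFilt_of_isHomogeneous ((rsq_isHomogeneous.pow m).mul hY))
    (by push_cast; omega)

end Summit.CriticalPhenomena.Ising3DConformalLimit.Theorems.HarmonicMomentsIsotropy.GaussianRung
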